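import Summits.HodgeConjecture.HodgeConjecture.Theses.SiuRepresentability
import Literature.AlgebraicGeometry.ShimuraVarieties.SpecialCycleClasses

/-!
Skeleton line for the split child `IndecomposableRepresentable` (stmt-HodgeConjecture-18155) of `KaehlerRepresentable` (stmt-HodgeConjecture-9029).
The composition concludes the ROUTE DECL by name (Theses/SiuRepresentability.lean rev 10).
-/


/-!
## Birth skeleton of the piece `IndecomposableRepresentable` (indecomposable sector of `KaehlerRepresentable`)

Line `indecomposable-sector` (theta part + non-theta supply + no-datum remainder): three registered
stubs and the kernel-checked composition `IndecomposableRepresentable_of`.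
-/

namespace Summit.HodgeConjecture.HodgeConjecture.Cruxes.KaehlerRepresentable.IndecomposableSector

open scoped Manifold ContinuousMap
open Summit.HodgeConjecture.HodgeConjecture.Theses.SiuRepresentability

/-- STUB 1 (theta classes are Kähler-representable; a theorem in kind, M/L-sized to formalise): on a
compact ball quotient carrying a unitary ball-quotient datum `D` (`X(ℂ) ≅ Γ \ 𝔹ⁿ`, `Γ` a torsion-free
congruence subgroup of `U(V)`, `V` hermitian of signature `(n,1)` over a CM field), the special cycle
classes of codimension `p` (classes supported on the special subvarieties `c(W)`, images of the totally
geodesic immersions `Γ_W \ 𝔹(W^⊥) → X(ℂ)` of smooth compact ball quotients of dimension `k = n - p`)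
lie in the span of the Kähler-representable classes: `cl(c(W)) ⌢ [X] = ι_*[Γ_W \ 𝔹^k]`, and
`ker(H²ᵖ(X) → H²ᵖ(X ∖ c(W))) = ℂ · cl(c(W))` (Fulton §19.1). [cite: BergeronMillsonMoeglin2016Balls, Part 2 §3.3]
[cite: FultonIntersectionTheory1998, §19.1 Lemma 19.1.1] -/
theorem stub_thetaRepresentable :
    ∀ ⦃n : ℕ⦄ ⦃X : Literature.AlgebraicGeometry.Motives.SchemeOver ℂ⦄ (hX : Literature.AlgebraicGeometry.Motives.IsSmoothProjective n X), (∃ (A : Literature.AlgebraicGeometry.HodgeTheory.HodgeModel n X) (π : EuclideanSpace ℂ (Fin n) → A.carrier), (∀ z ∈ Metric.ball (0 : EuclideanSpace ℂ (Fin n)) 1, MDifferentiableAt 𝓘(ℂ, EuclideanSpace ℂ (Fin n)) 𝓘(ℂ, A.model) π z) ∧ IsCoveringMap ((Metric.ball (0 : EuclideanSpace ℂ (Fin n)) 1).restrict π)) → ∀ (D : Literature.AlgebraicGeometry.ShimuraVarieties.UnitaryBallQuotientDatum n X) (p k : ℕ) (hpk : p + k = n), 2 ≤ p → 2 * p ≤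 n → Literature.AlgebraicGeometry.ShimuraVarieties.specialCycleClasses D p ≤ Submodule.span ℂ {c' : Literature.AlgebraicGeometry.HodgeTheory.complexBetti X (2 * p) | ∃ (μX : Literature.AlgebraicTopology.SingularHomology.HomologicalOrientation ℂ (Literature.AlgebraicGeometry.Motives.ComplexPoints X) (2 * n)) (M : Literature.AlgebraicGeometry.Motives.SchemeOver ℂ) (_ : Literature.AlgebraicGeometry.Motives.IsSmoothProjective k M) (μM : Literature.AlgebraicTopology.SingularHomology.HomologicalOrientation ℂ (Literature.AlgebraicGeometry.Motives.ComplexPoints M) (2 * k)) (f : C(Literature.AlgebraicGeometry.Motives.ComplexPoints M, Literature.AlgebraicGeometry.Motives.ComplexPoints X)), Literature.AlgebraicTopology.SingularHomology.capProduct (show 2 * p + 2 * k = 2 * n by omega) c' μX.fundamentalClass = Literature.AlgebraicTopology.SingularHomology.singularHomology.map ℂ ℂ f (2 * k) μM.fundamentalClass} := by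
  sorry

/-- STUB 2 (non-theta supply, THE HEART; BMM Thm. 4 gives it for `3p < n`, conditionally): on a compact
ball quotient with a unitary datum `D`, every rational Hodge `(p,p)`-class, `2 ≤ p ≤ n/2`, is a special
cycle class plus a combination of Kähler-representable classes and decomposable Hodge classes
`Hdg^i · Hdg^j` (`i + j = p`, `i, j ≥ 1`; these contain BMM's Lefschetz shifts `L^(p-t) · SC^t` and the
products `SC × H^(1,1)`). In the middle third `]n/3, n/2]` this asks for NON-THETA representable classes
(non-geodesic Kähler subvarieties / Kähler-group classes: Toledo, Deraux forgetful maps, Hecke spreading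
of one seed). [cite: BergeronMillsonMoeglin2016Balls, §1.7 Thm. 4 and §1.3 Cor. 2] -/
theorem stub_arithmeticSupply :
    ∀ ⦃n : ℕ⦄ ⦃X : Literature.AlgebraicGeometry.Motives.SchemeOver ℂ⦄ (hX : Literature.AlgebraicGeometry.Motives.IsSmoothProjective n X), (∃ (A : Literature.AlgebraicGeometry.HodgeTheory.HodgeModel n X) (π : EuclideanSpace ℂ (Fin n) → A.carrier), (∀ z ∈ Metric.ball (0 : EuclideanSpace ℂ (Fin n)) 1, MDifferentiableAt 𝓘(ℂ, EuclideanSpace ℂ (Fin n)) 𝓘(ℂ, A.model) π z) ∧ IsCoveringMap ((Metric.ball (0 : EuclideanSpace ℂ (Fin n)) 1).restrict π)) → ∀ (D : Literature.AlgebraicGeometry.ShimuraVarieties.UnitaryBallQuotientDatum n X), ∀ (p k : ℕ) (hpk : p + k = n), 2 ≤ p → 2 * p ≤ n → ∀ c : Literature.AlgebraicGeometry.HodgeTheory.complexBetti X (2 * p), Literature.AlgebraicGeometry.HodgeTheory.IsRationalClass c → Literature.AlgebraicGeometry.HodgeTheory.IsOfHodgeType n X (2 * p) p p c → c ∈ Literature.AlgebraicGeometry.ShimuraVarieties.specialCycleClasses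 D p ⊔ Submodule.span ℂ ({c' : Literature.AlgebraicGeometry.HodgeTheory.complexBetti X (2 * p) | ∃ (μX : Literature.AlgebraicTopology.SingularHomology.HomologicalOrientation ℂ (Literature.AlgebraicGeometry.Motives.ComplexPoints X) (2 * n)) (M : Literature.AlgebraicGeometry.Motives.SchemeOver ℂ) (_ : Literature.AlgebraicGeometry.Motives.IsSmoothProjective k M) (μM : Literature.AlgebraicTopology.SingularHomology.HomologicalOrientation ℂ (Literature.AlgebraicGeometry.Motives.ComplexPoints M) (2 * k)) (f : C(Literature.AlgebraicGeometry.Motives.ComplexPoints M, Literature.AlgebraicGeometry.Motives.ComplexPoints X)), Literature.AlgebraicTopology.SingularHomology.capProduct (show 2 * p + 2 * k = 2 * n by omega) c' μX.fundamentalClass = Literature.AlgebraicTopology.SingularHomology.singularHomology.map ℂ ℂ f (2 * k) μM.fundamentalClass} ∪ {d : Literature.AlgebraicGeometry.HodgeTheory.complexBetti X (2 * p) | ∃ (i j : ℕ) (hij : i + j = p) (_ : 1 ≤ i) (_ : 1 ≤ j) (a : Literature.AlgebraicGeometry.HodgeTheory.complexBetti X (2 * i)) (b : Literature.AlgebraicGeometry.HodgeTheory.complexBetti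 X (2 * j)), Literature.AlgebraicGeometry.HodgeTheory.IsRationalClass a ∧ Literature.AlgebraicGeometry.HodgeTheory.IsOfHodgeType n X (2 * i) i i a ∧ Literature.AlgebraicGeometry.HodgeTheory.IsRationalClass b ∧ Literature.AlgebraicGeometry.HodgeTheory.IsOfHodgeType n X (2 * j) j j b ∧ d = Literature.AlgebraicTopology.SingularHomology.cupProduct (show 2 * i + 2 * j = 2 * p by omega) a b}) := by
  sorry

/-- STUB 3 (the remainder WITHOUT a unitary datum of the first kind: arithmetic quotients of the second
kind `U(D, h)` — division algebras, where special sub-ball quotients of small codimension are absent — and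
the non-arithmetic lattices, known for `n ≤ 3` only): the piece for compact ball quotients `X` admitting
no `UnitaryBallQuotientDatum n X`. [cite: BergeronMillsonMoeglin2016Balls, §1.1] -/
theorem stub_noDatumSupply :
    ∀ ⦃n : ℕ⦄ ⦃X : Literature.AlgebraicGeometry.Motives.SchemeOver ℂ⦄ (hX : Literature.AlgebraicGeometry.Motives.IsSmoothProjective n X), (∃ (A : Literature.AlgebraicGeometry.HodgeTheory.HodgeModel n X) (π : EuclideanSpace ℂ (Fin n) → A.carrier), (∀ z ∈ Metric.ball (0 : EuclideanSpace ℂ (Fin n)) 1, MDifferentiableAt 𝓘(ℂ, EuclideanSpace ℂ (Fin n)) 𝓘(ℂ, A.model) π z) ∧ IsCoveringMap ((Metric.ball (0 : EuclideanSpace ℂ (Fin n)) 1).restrict π)) → IsEmpty (Literature.AlgebraicGeometry.ShimuraVarieties.UnitaryBallQuotientDatum n X) → ∀ (p k : ℕ) (hpk : p + k = n), 2 ≤ p → 2 * p ≤ n → ∀ c : Literature.AlgebraicGeometry.HodgeTheory.complexBetti X (2 * p), Literature.AlgebraicGeometry.HodgeTheory.IsRationalClass c → Literature.AlgebraicGeometry.HodgeTheory.IsOfHodgeType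 n X (2 * p) p p c → c ∈ Submodule.span ℂ ({c' : Literature.AlgebraicGeometry.HodgeTheory.complexBetti X (2 * p) | ∃ (μX : Literature.AlgebraicTopology.SingularHomology.HomologicalOrientation ℂ (Literature.AlgebraicGeometry.Motives.ComplexPoints X) (2 * n)) (M : Literature.AlgebraicGeometry.Motives.SchemeOver ℂ) (_ : Literature.AlgebraicGeometry.Motives.IsSmoothProjective k M) (μM : Literature.AlgebraicTopology.SingularHomology.HomologicalOrientation ℂ (Literature.AlgebraicGeometry.Motives.ComplexPoints M) (2 * k)) (f : C(Literature.AlgebraicGeometry.Motives.ComplexPoints M, Literature.AlgebraicGeometry.Motives.ComplexPoints X)), Literature.AlgebraicTopology.SingularHomology.capProduct (show 2 * p + 2 * k = 2 * n by omega) c' μX.fundamentalClass = Literature.AlgebraicTopology.SingularHomology.singularHomology.map ℂ ℂ f (2 * k) μM.fundamentalClass} ∪ {d : Literature.AlgebraicGeometry.HodgeTheory.complexBetti X (2 * p) | ∃ (i j : ℕ) (hij : i + j = p) (_ : 1 ≤ i) (_ : 1 ≤ j) (a : Literature.AlgebraicGeometry.HodgeTheory.complexBetti X (2 * i)) (b :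 Literature.AlgebraicGeometry.HodgeTheory.complexBetti X (2 * j)), Literature.AlgebraicGeometry.HodgeTheory.IsRationalClass a ∧ Literature.AlgebraicGeometry.HodgeTheory.IsOfHodgeType n X (2 * i) i i a ∧ Literature.AlgebraicGeometry.HodgeTheory.IsRationalClass b ∧ Literature.AlgebraicGeometry.HodgeTheory.IsOfHodgeType n X (2 * j) j j b ∧ d = Literature.AlgebraicTopology.SingularHomology.cupProduct (show 2 * i + 2 * j = 2 * p by omega) a b}) := by
  sorry

/-- COMPOSITION (kernel-checked, no sorry): dichotomy on the existence of a unitary datum; in the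
arithmetic case the theta part of STUB 2's decomposition is absorbed into the representable span by
STUB 1 (`sup_le`), in the other case STUB 3 is the statement. [cite: BergeronMillsonMoeglin2016Balls, §1.7] -/
theorem IndecomposableRepresentable_of :
    (∀ ⦃n : ℕ⦄ ⦃X : Literature.AlgebraicGeometry.Motives.SchemeOver ℂ⦄ (hX : Literature.AlgebraicGeometry.Motives.IsSmoothProjective n X), (∃ (A : Literature.AlgebraicGeometry.HodgeTheory.HodgeModel n X) (π : EuclideanSpace ℂ (Fin n) → A.carrier), (∀ z ∈ Metric.ball (0 : EuclideanSpace ℂ (Fin n)) 1, MDifferentiableAt 𝓘(ℂ, EuclideanSpace ℂ (Fin n)) 𝓘(ℂ, A.model) π z) ∧ IsCoveringMap ((Metric.ball (0 : EuclideanSpace ℂ (Fin n)) 1).restrict π)) → ∀ (D : Literature.AlgebraicGeometry.ShimuraVarieties.UnitaryBallQuotientDatum n X) (p k : ℕ) (hpk : p + k = n), 2 ≤ p → 2 * p ≤ n → Literature.AlgebraicGeometry.ShimuraVarieties.specialCycleClasses D p ≤ Submodule.span ℂ {c' : Literature.AlgebraicGeometry.HodgeTheory.complexBetti X (2 * p)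 | ∃ (μX : Literature.AlgebraicTopology.SingularHomology.HomologicalOrientation ℂ (Literature.AlgebraicGeometry.Motives.ComplexPoints X) (2 * n)) (M : Literature.AlgebraicGeometry.Motives.SchemeOver ℂ) (_ : Literature.AlgebraicGeometry.Motives.IsSmoothProjective k M) (μM : Literature.AlgebraicTopology.SingularHomology.HomologicalOrientation ℂ (Literature.AlgebraicGeometry.Motives.ComplexPoints M) (2 * k)) (f : C(Literature.AlgebraicGeometry.Motives.ComplexPoints M, Literature.AlgebraicGeometry.Motives.ComplexPoints X)), Literature.AlgebraicTopology.SingularHomology.capProduct (show 2 * p + 2 * k = 2 * n by omega) c' μX.fundamentalClass = Literature.AlgebraicTopology.SingularHomology.singularHomology.map ℂ ℂ f (2 * k) μM.fundamentalClass}) →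
    (∀ ⦃n : ℕ⦄ ⦃X : Literature.AlgebraicGeometry.Motives.SchemeOver ℂ⦄ (hX : Literature.AlgebraicGeometry.Motives.IsSmoothProjective n X), (∃ (A : Literature.AlgebraicGeometry.HodgeTheory.HodgeModel n X) (π : EuclideanSpace ℂ (Fin n) → A.carrier), (∀ z ∈ Metric.ball (0 : EuclideanSpace ℂ (Fin n)) 1, MDifferentiableAt 𝓘(ℂ, EuclideanSpace ℂ (Fin n)) 𝓘(ℂ, A.model) π z) ∧ IsCoveringMap ((Metric.ball (0 : EuclideanSpace ℂ (Fin n)) 1).restrict π)) → ∀ (D : Literature.AlgebraicGeometry.ShimuraVarieties.UnitaryBallQuotientDatum n X), ∀ (p k : ℕ) (hpk : p + k = n), 2 ≤ p → 2 * p ≤ n → ∀ c : Literature.AlgebraicGeometry.HodgeTheory.complexBetti X (2 * p), Literature.AlgebraicGeometry.HodgeTheory.IsRationalClass c → Literature.AlgebraicGeometry.HodgeTheory.IsOfHodgeType n X (2 * p) p p c → c ∈ Literature.AlgebraicGeometry.ShimuraVarieties.specialCycleClasses D p ⊔ Submodule.span ℂ ({c' : Literature.AlgebraicGeometry.HodgeTheory.complexBetti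 X (2 * p) | ∃ (μX : Literature.AlgebraicTopology.SingularHomology.HomologicalOrientation ℂ (Literature.AlgebraicGeometry.Motives.ComplexPoints X) (2 * n)) (M : Literature.AlgebraicGeometry.Motives.SchemeOver ℂ) (_ : Literature.AlgebraicGeometry.Motives.IsSmoothProjective k M) (μM : Literature.AlgebraicTopology.SingularHomology.HomologicalOrientation ℂ (Literature.AlgebraicGeometry.Motives.ComplexPoints M) (2 * k)) (f : C(Literature.AlgebraicGeometry.Motives.ComplexPoints M, Literature.AlgebraicGeometry.Motives.ComplexPoints X)), Literature.AlgebraicTopology.SingularHomology.capProduct (show 2 * p + 2 * k = 2 * n by omega) c' μX.fundamentalClass = Literature.AlgebraicTopology.SingularHomology.singularHomology.map ℂ ℂ f (2 * k) μM.fundamentalClass} ∪ {d : Literature.AlgebraicGeometry.HodgeTheory.complexBetti X (2 * p) | ∃ (i j : ℕ) (hij : i + j = p) (_ : 1 ≤ i) (_ : 1 ≤ j) (a : Literature.AlgebraicGeometry.HodgeTheory.complexBetti X (2 * i)) (b : Literature.AlgebraicGeometry.HodgeTheory.complexBetti X (2 * j)), Literature.AlgebraicGeometry.HodgeTheory.IsRationalClass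 a ∧ Literature.AlgebraicGeometry.HodgeTheory.IsOfHodgeType n X (2 * i) i i a ∧ Literature.AlgebraicGeometry.HodgeTheory.IsRationalClass b ∧ Literature.AlgebraicGeometry.HodgeTheory.IsOfHodgeType n X (2 * j) j j b ∧ d = Literature.AlgebraicTopology.SingularHomology.cupProduct (show 2 * i + 2 * j = 2 * p by omega) a b})) →
    (∀ ⦃n : ℕ⦄ ⦃X : Literature.AlgebraicGeometry.Motives.SchemeOver ℂ⦄ (hX : Literature.AlgebraicGeometry.Motives.IsSmoothProjective n X), (∃ (A : Literature.AlgebraicGeometry.HodgeTheory.HodgeModel n X) (π : EuclideanSpace ℂ (Fin n) → A.carrier), (∀ z ∈ Metric.ball (0 : EuclideanSpace ℂ (Fin n)) 1, MDifferentiableAt 𝓘(ℂ, EuclideanSpace ℂ (Fin n)) 𝓘(ℂ, A.model) π z) ∧ IsCoveringMap ((Metric.ball (0 : EuclideanSpace ℂ (Fin n)) 1).restrict π)) → IsEmpty (Literature.AlgebraicGeometry.ShimuraVarieties.UnitaryBallQuotientDatum n X) → ∀ (p k : ℕ) (hpk : p + k = n), 2 ≤ p → 2 * p ≤ n → ∀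 c : Literature.AlgebraicGeometry.HodgeTheory.complexBetti X (2 * p), Literature.AlgebraicGeometry.HodgeTheory.IsRationalClass c → Literature.AlgebraicGeometry.HodgeTheory.IsOfHodgeType n X (2 * p) p p c → c ∈ Submodule.span ℂ ({c' : Literature.AlgebraicGeometry.HodgeTheory.complexBetti X (2 * p) | ∃ (μX : Literature.AlgebraicTopology.SingularHomology.HomologicalOrientation ℂ (Literature.AlgebraicGeometry.Motives.ComplexPoints X) (2 * n)) (M : Literature.AlgebraicGeometry.Motives.SchemeOver ℂ) (_ : Literature.AlgebraicGeometry.Motives.IsSmoothProjective k M) (μM : Literature.AlgebraicTopology.SingularHomology.HomologicalOrientation ℂ (Literature.AlgebraicGeometry.Motives.ComplexPoints M) (2 * k)) (f : C(Literature.AlgebraicGeometry.Motives.ComplexPoints M, Literature.AlgebraicGeometry.Motives.ComplexPoints X)), Literature.AlgebraicTopology.SingularHomology.capProduct (show 2 * p + 2 * k = 2 * n by omega) c' μX.fundamentalClass = Literature.AlgebraicTopology.SingularHomology.singularHomology.map ℂ ℂ f (2 * k) μM.fundamentalClass} ∪ {d : Literature.AlgebraicGeometry.HodgeTheory.complexBetti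 X (2 * p) | ∃ (i j : ℕ) (hij : i + j = p) (_ : 1 ≤ i) (_ : 1 ≤ j) (a : Literature.AlgebraicGeometry.HodgeTheory.complexBetti X (2 * i)) (b : Literature.AlgebraicGeometry.HodgeTheory.complexBetti X (2 * j)), Literature.AlgebraicGeometry.HodgeTheory.IsRationalClass a ∧ Literature.AlgebraicGeometry.HodgeTheory.IsOfHodgeType n X (2 * i) i i a ∧ Literature.AlgebraicGeometry.HodgeTheory.IsRationalClass b ∧ Literature.AlgebraicGeometry.HodgeTheory.IsOfHodgeType n X (2 * j) j j b ∧ d = Literature.AlgebraicTopology.SingularHomology.cupProduct (show 2 * i + 2 * j = 2 * p by omega) a b})) →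
    IndecomposableRepresentable := by
  intro hθ hA hN n X hX hB p k hpk hp h2p c hc hh
  by_cases hD : Nonempty (Literature.AlgebraicGeometry.ShimuraVarieties.UnitaryBallQuotientDatum n X)
  · obtain ⟨D⟩ := hD
    have hc' := hA hX hB D p k hpk hp h2p c hc hh
    have hle : Literature.AlgebraicGeometry.ShimuraVarieties.specialCycleClasses D p ⊔
        Submodule.span ℂ ({c' : Literature.AlgebraicGeometry.HodgeTheory.complexBetti X (2 * p) | ∃ (μX : Literature.AlgebraicTopology.SingularHomology.HomologicalOrientation ℂ (Literature.AlgebraicGeometry.Motives.ComplexPoints X) (2 * n)) (M : Literature.AlgebraicGeometry.Motives.SchemeOver ℂ) (_ : Literature.AlgebraicGeometry.Motives.IsSmoothProjective k M) (μM : Literature.AlgebraicTopology.SingularHomology.HomologicalOrientation ℂ (Literature.AlgebraicGeometry.Motives.ComplexPoints M) (2 * k)) (f : C(Literature.AlgebraicGeometry.Motives.ComplexPoints M, Literature.AlgebraicGeometry.Motives.ComplexPoints X)), Literature.AlgebraicTopology.SingularHomology.capProduct (show 2 * p + 2 * k = 2 * n by omega) c' μX.fundamentalClass = Literature.AlgebraicTopology.SingularHomology.singularHomology.map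 ℂ ℂ f (2 * k) μM.fundamentalClass} ∪ {d : Literature.AlgebraicGeometry.HodgeTheory.complexBetti X (2 * p) | ∃ (i j : ℕ) (hij : i + j = p) (_ : 1 ≤ i) (_ : 1 ≤ j) (a : Literature.AlgebraicGeometry.HodgeTheory.complexBetti X (2 * i)) (b : Literature.AlgebraicGeometry.HodgeTheory.complexBetti X (2 * j)), Literature.AlgebraicGeometry.HodgeTheory.IsRationalClass a ∧ Literature.AlgebraicGeometry.HodgeTheory.IsOfHodgeType n X (2 * i) i i a ∧ Literature.AlgebraicGeometry.HodgeTheory.IsRationalClass b ∧ Literature.AlgebraicGeometry.HodgeTheory.IsOfHodgeType n X (2 * j) j j b ∧ d = Literature.AlgebraicTopology.SingularHomology.cupProduct (show 2 * i + 2 * j = 2 * p by omega) a b}) ≤ Submodule.span ℂ ({c' : Literature.AlgebraicGeometry.HodgeTheory.complexBetti X (2 * p) | ∃ (μX : Literature.AlgebraicTopology.SingularHomology.HomologicalOrientation ℂ (Literature.AlgebraicGeometry.Motives.ComplexPoints X) (2 * n)) (M : Literature.AlgebraicGeometry.Motives.SchemeOver ℂ) (_ : Literature.AlgebraicGeometry.Motives.IsSmoothProjective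 k M) (μM : Literature.AlgebraicTopology.SingularHomology.HomologicalOrientation ℂ (Literature.AlgebraicGeometry.Motives.ComplexPoints M) (2 * k)) (f : C(Literature.AlgebraicGeometry.Motives.ComplexPoints M, Literature.AlgebraicGeometry.Motives.ComplexPoints X)), Literature.AlgebraicTopology.SingularHomology.capProduct (show 2 * p + 2 * k = 2 * n by omega) c' μX.fundamentalClass = Literature.AlgebraicTopology.SingularHomology.singularHomology.map ℂ ℂ f (2 * k) μM.fundamentalClass} ∪ {d : Literature.AlgebraicGeometry.HodgeTheory.complexBetti X (2 * p) | ∃ (i j : ℕ) (hij : i + j = p) (_ : 1 ≤ i) (_ : 1 ≤ j) (a : Literature.AlgebraicGeometry.HodgeTheory.complexBetti X (2 * i)) (b : Literature.AlgebraicGeometry.HodgeTheory.complexBetti X (2 * j)), Literature.AlgebraicGeometry.HodgeTheory.IsRationalClass a ∧ Literature.AlgebraicGeometry.HodgeTheory.IsOfHodgeType n X (2 * i) i i a ∧ Literature.AlgebraicGeometry.HodgeTheory.IsRationalClass b ∧ Literature.AlgebraicGeometry.HodgeTheory.IsOfHodgeType n X (2 * j) j j b ∧ d = Literature.AlgebraicTopology.SingularHomology.cupProduct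 (show 2 * i + 2 * j = 2 * p by omega) a b}) :=
      sup_le ((hθ hX hB D p k hpk hp h2p).trans (Submodule.span_mono Set.subset_union_left)) le_rfl
    exact hle hc'
  · exact hN hX hB (not_nonempty_iff.mp hD) p k hpk hp h2p c hc hh

/-- The line concludes the piece from its registered stubs. -/
theorem IndecomposableRepresentable_of_stubs : IndecomposableRepresentable :=
  IndecomposableRepresentable_of stub_thetaRepresentable stub_arithmeticSupply stub_noDatumSupply

end Summit.HodgeConjecture.HodgeConjecture.Cruxes.KaehlerRepresentable.IndecomposableSector
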